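import Literature.Geometry.Lorentzian.GreenIdentityLipschitz
import HarnessLib

/-!
# Inverse mean curvature flow I — proofs: classical solutions of the elliptic regularisation
# `div(∇u/√(|∇u|² + ε²)) = √(|∇u|² + ε²)` are `ε`-approximate weak solutions

Huisken–Ilmanen construct weak solutions of the inverse mean curvature flow (J. Differential
Geom. 59 (2001), Thm. 3.1) as limits `ε → 0` of smooth solutions `u^ε` of the *elliptic
regularisation* (⋆)_ε, `E^ε u := div(∇u / √(|∇u|² + ε²)) − √(|∇u|² + ε²) = 0` (§3, (⋆)_ε,
p. 25–26), passing to the limit through the translating solutions `U(x, z) = u(x) − εz` of the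
flow in `M × ℝ` (Lemma 2.3 + Compactness Theorem 2.1). This file proves the estimate which allows
to pass to the limit *directly on `M`*: a classical solution of (⋆)_ε on an open set `W` is an
**`ε`-approximate weak solution** of (1.5) on `W`,

  `J_u^K(u) ≤ J_u^K(v) + ε (μ_h(K) + ∫_K |v − u| dμ_h)`

for every locally Lipschitz competitor `v` with `{v ≠ u} ∩ W ⊆ K ⊆ W` compact
(`imcfEnergy_le_add_of_regularised`). The proof is the calibration argument of Huisken–Ilmanen's
Smooth Flow Lemma 2.3 (p. 23: "`ν = ∇u/|∇u|` … `div ν = H > 0` … integrate `∇(v − u) · ν`") run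
with the regularised unit field `ν_ε = ∇u / ψ`, `ψ = √(|∇u|² + ε²)`: a.e.
`|∇v| ≥ ⟨∇v, ν_ε⟩ = |∇u|²/ψ + ⟨∇(v − u), ν_ε⟩ ≥ |∇u| − ε + ⟨∇(v − u), ν_ε⟩`, and by Green's
identity against the Lipschitz test function `(v − u)/ψ`
(`integral_mul_dalembertian_eq_neg_integral_innerDual_of_isLocLipschitzOn`,
`GreenIdentityLipschitz.lean`) and the equation, `∫ ⟨∇(v − u), ν_ε⟩ = −∫ (v − u) ψ`, while
`0 ≤ ψ − |∇u| ≤ ε`.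

The equation is taken in the classical, expanded form `ψ Δ_h u − h⁻¹(dψ, du) = ψ³` on `W`
(i.e. `div(∇u/ψ) = (ψ Δu − ⟨∇ψ, ∇u⟩)/ψ² = ψ`), for `u ∈ C²(X)` and `ψ ∈ C¹(W)`.

Also proved here: the Cauchy–Schwarz inequality `h⁻¹(dv, du) ≤ |∇v| |∇u|`
(`innerDual_le_gradNorm_mul_gradNorm`), `C¹` on an open set implies locally Lipschitz there
(`isLocLipschitzOn_of_contMDiffOn`), the quotient rule for `mvfderiv`, and the integrability of
`h⁻¹(dw, du)` for `w` locally Lipschitz with compact support (`integrable_innerDual_of_hasCompactSupport`).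

Everything is proved; there are no definitions and no named facts.

## References

* G. Huisken, T. Ilmanen, *The inverse mean curvature flow and the Riemannian Penrose
  inequality*, J. Differential Geom. 59 (2001) 353–437: §2, proof of the Smooth Flow Lemma 2.3
  (calibration by `ν = ∇u/|∇u|`); §3, the elliptic regularisation (⋆)_ε and the proof of Thm. 3.1.
-/

noncomputable section

open Bundle Set Function Filter Manifold MeasureTheory
open scoped Manifold ContDiff Topology ENNReal NNReal

namespace Literature.Geometry.Lorentzian

open PseudoRiemannianMetric

variable {X : Type*} [TopologicalSpace X] [ChartedSpace E3 X] [IsManifold (𝓡 3) ∞ X]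
  (h : ContMDiffRiemannianMetric (𝓡 3) ∞ E3 (TangentSpace (𝓡 3) : X → Type _))

/-! ### Pointwise linear algebra of the inverse metric -/

section Pointwise

set_option backward.isDefEq.respectTransparency false in
/-- `√(h⁻¹(α, α)) = ‖♯α‖` for every covector `α` (the musical isomorphism is an isometry).
[folklore] -/
theorem sqrt_innerDual_self_eq_norm_sharp (x : X) (α : Module.Dual ℝ (TangentSpace (𝓡 3) x)) :
    letI : RiemannianBundle (fun x : X ↦ TangentSpace (𝓡 3) x) :=
      ⟨h.toContinuousRiemannianMetric.toRiemannianMetric⟩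
    Real.sqrt ((ofRiemannian h).innerDual x α α) = ‖(ofRiemannian h).sharp x α‖ := by
  letI : RiemannianBundle (fun x : X ↦ TangentSpace (𝓡 3) x) :=
    ⟨h.toContinuousRiemannianMetric.toRiemannianMetric⟩
  rw [← Real.sqrt_sq (norm_nonneg _), ← real_inner_self_eq_norm_sq]
  congr 1
  change α ((ofRiemannian h).sharp x α) = h.inner x _ _
  rw [← val_ofRiemannian, val_sharp_apply]

/-- **The slope is the length of the gradient**: `|∇u|(x) = ‖♯du_x‖_x`. [folklore] -/
theorem gradNorm_eq_norm_sharp (u : X → ℝ) (x : X) :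
    letI : RiemannianBundle (fun x : X ↦ TangentSpace (𝓡 3) x) :=
      ⟨h.toContinuousRiemannianMetric.toRiemannianMetric⟩
    gradNorm h u x = ‖(ofRiemannian h).sharp x (mvfderiv (𝓡 3) u x).toLinearMap‖ := by
  unfold gradNorm
  exact sqrt_innerDual_self_eq_norm_sharp h x _

set_option backward.isDefEq.respectTransparency false in
/-- **Cauchy–Schwarz for the inverse metric**: `h⁻¹(dv, du)(x) ≤ |∇v|(x) |∇u|(x)`
(`h⁻¹(α, β) = ⟨♯α, ♯β⟩`). [folklore] -/
theorem innerDual_le_gradNorm_mul_gradNorm (v u : X → ℝ) (x : X) :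
    (ofRiemannian h).innerDual x (mvfderiv (𝓡 3) v x).toLinearMap
      (mvfderiv (𝓡 3) u x).toLinearMap ≤ gradNorm h v x * gradNorm h u x := by
  letI : RiemannianBundle (fun x : X ↦ TangentSpace (𝓡 3) x) :=
    ⟨h.toContinuousRiemannianMetric.toRiemannianMetric⟩
  rw [gradNorm_eq_norm_sharp h v x, gradNorm_eq_norm_sharp h u x, innerDual_eq_val_sharp_sharp,
    val_ofRiemannian]
  exact real_inner_le_norm ((ofRiemannian h).sharp x _) ((ofRiemannian h).sharp x _)

/-- `h⁻¹(du, du)(x) = |∇u|(x)²`. [folklore] -/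
theorem innerDual_self_eq_gradNorm_sq (u : X → ℝ) (x : X) :
    (ofRiemannian h).innerDual x (mvfderiv (𝓡 3) u x).toLinearMap
      (mvfderiv (𝓡 3) u x).toLinearMap = gradNorm h u x ^ 2 := by
  unfold gradNorm
  rw [Real.sq_sqrt (innerDual_self_nonneg h x _)]
  rfl

/-- The inverse metric is homogeneous in the first covector (universe-polymorphic copy of
`MassCapacityHarmonic.lean`'s `innerDual_smul_left`, which is stated for `X : Type`). [folklore] -/
theorem innerDual_smul_left' (x : X) (c : ℝ) (α γ : Module.Dual ℝ (TangentSpace (𝓡 3) x)) :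
    (ofRiemannian h).innerDual x (c • α) γ = c * (ofRiemannian h).innerDual x α γ := by
  simp only [PseudoRiemannianMetric.innerDual, LinearMap.smul_apply, smul_eq_mul]

/-- The inverse metric is additive in the first covector. [folklore] -/
theorem innerDual_add_left (x : X) (α β γ : Module.Dual ℝ (TangentSpace (𝓡 3) x)) :
    (ofRiemannian h).innerDual x (α + β) γ =
      (ofRiemannian h).innerDual x α γ + (ofRiemannian h).innerDual x β γ := by
  simp only [PseudoRiemannianMetric.innerDual, LinearMap.add_apply]

omit [IsManifold (𝓡 3) ∞ X] in
set_option backward.isDefEq.respectTransparency false in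
/-- **Quotient rule, applied form**: for `f, ψ` differentiable at `x` with `ψ` nowhere zero,
`d(f/ψ)_x(v) = df_x(v)/ψ(x) − f(x) dψ_x(v)/ψ(x)²`. [folklore] -/
theorem mvfderiv_div_apply {f ψ : X → ℝ} {x : X} (hf : MDifferentiableAt (𝓡 3) 𝓘(ℝ, ℝ) f x)
    (hψ : MDifferentiableAt (𝓡 3) 𝓘(ℝ, ℝ) ψ x) (hne : ∀ y, ψ y ≠ 0) (v : TangentSpace (𝓡 3) x) :
    mvfderiv (𝓡 3) (fun y ↦ f y * (ψ y)⁻¹) x v =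
      mvfderiv (𝓡 3) f x v / ψ x - f x * mvfderiv (𝓡 3) ψ x v / ψ x ^ 2 := by
  -- `ψ⁻¹` is differentiable at `x`
  have hinvR : HasMFDerivAt 𝓘(ℝ, ℝ) 𝓘(ℝ, ℝ) (fun t : ℝ ↦ t⁻¹) (ψ x)
      (ContinuousLinearMap.smulRight (1 : ℝ →L[ℝ] ℝ) (-((ψ x) ^ 2)⁻¹)) :=
    hasMFDerivAt_iff_hasFDerivAt.mpr (hasDerivAt_inv (hne x)).hasFDerivAt
  have hinv : MDifferentiableAt (𝓡 3) 𝓘(ℝ, ℝ) (fun y ↦ (ψ y)⁻¹) x :=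
    (hinvR.comp x hψ.hasMFDerivAt).mdifferentiableAt
  rw [mvfderiv_mul_apply hf hinv v]
  have hI := mvfderiv_inv_eq (I := 𝓡 3) hψ hinv hne
  have hIv : mvfderiv (𝓡 3) (fun y ↦ (ψ y)⁻¹) x v = -((ψ x)⁻¹ * (ψ x)⁻¹) * mvfderiv (𝓡 3) ψ x v := by
    rw [hI]; rfl
  rw [hIv]
  have hx := hne x
  field_simp
  ring

end Pointwise

/-! ### Local Lipschitz continuity of `C¹` functions on an open set, and of reciprocals -/

section LocLipschitz

variable [T2Space X] [LocallyCompactSpace X]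

set_option backward.isDefEq.respectTransparency false in
/-- **`C¹` on an open set ⟹ locally Lipschitz there** (Riemannian distance): the local version of
`isLocLipschitzOn_of_contMDiff` (charts are locally bi-Lipschitz, `C¹` representatives are locally
Lipschitz). [folklore] -/
theorem isLocLipschitzOn_of_contMDiffOn {f : X → ℝ} {W : Set X} (hW : IsOpen W)
    (hf : ContMDiffOn (𝓡 3) 𝓘(ℝ, ℝ) 1 f W) : IsLocLipschitzOn h f W := by
  letI : RiemannianBundle (fun x : X ↦ TangentSpace (𝓡 3) x) :=
    ⟨h.toContinuousRiemannianMetric.toRiemannianMetric⟩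
  letI : PseudoEMetricSpace X := .ofRiemannianMetric (𝓡 3) X
  change LocallyLipschitzOn W f
  intro p hpW
  set φ := extChartAt (𝓡 3) p with hφ
  have hsymm : ContMDiffAt 𝓘(ℝ, E3) (𝓡 3) 1 φ.symm (φ p) :=
    ((contMDiffOn_extChartAt_symm (n := ∞) p).contMDiffAt
      ((isOpen_extChartAt_target p).mem_nhds (mem_extChartAt_target p))).of_le
      (by exact_mod_cast le_top)
  have hcomp : ContMDiffAt 𝓘(ℝ, E3) 𝓘(ℝ, ℝ) 1 (f ∘ φ.symm) (φ p) := by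
    have hfp : ContMDiffAt (𝓡 3) 𝓘(ℝ, ℝ) 1 f (φ.symm (φ p)) := by
      rw [hφ, extChartAt_to_inv]; exact hf.contMDiffAt (hW.mem_nhds hpW)
    exact hfp.comp (φ p) hsymm
  obtain ⟨L, t, ht, hL⟩ := (contMDiffAt_iff_contDiffAt.1 hcomp).exists_lipschitzOnWith
  obtain ⟨A, hA⟩ := exists_norm_eq_norm_symmL (I := 𝓡 3) p p
  obtain ⟨Ae, hAe⟩ := exists_continuousLinearEquiv_of_norm_eq_norm_symmL (I := 𝓡 3) p p
    (mem_chart_source E3 p) hA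
  obtain ⟨U, hU, hUsrc, -, hge⟩ :=
    exists_nhds_riemannianEDist_le_and_edist_le (I := 𝓡 3) p p (mem_chart_source E3 p) hA
      one_lt_two
  have hsrc : U ⊆ φ.source := by rw [hφ, extChartAt_source]; exact hUsrc
  have htp : φ ⁻¹' t ∈ 𝓝 p := (continuousAt_extChartAt p).preimage_mem_nhds ht
  refine ⟨L * (‖(Ae.symm : E3 →L[ℝ] E3)‖₊ * 2), U ∩ φ ⁻¹' t,
    mem_nhdsWithin_of_mem_nhds (inter_mem hU htp), ?_⟩
  intro q hq q' hq'
  have hq1 : f q = (f ∘ φ.symm) (φ q) := by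
    simp only [Function.comp_apply, φ.left_inv (hsrc hq.1)]
  have hq'1 : f q' = (f ∘ φ.symm) (φ q') := by
    simp only [Function.comp_apply, φ.left_inv (hsrc hq'.1)]
  have hAq : ∀ z : E3, z = Ae.symm (A z) := fun z ↦ by
    rw [← hAe z, ContinuousLinearEquiv.symm_apply_apply]
  calc edist (f q) (f q') = edist ((f ∘ φ.symm) (φ q)) ((f ∘ φ.symm) (φ q')) := by rw [hq1, hq'1]
    _ ≤ L * edist (φ q) (φ q') := hL hq.2 hq'.2
    _ = L * edist (Ae.symm (A (φ q))) (Ae.symm (A (φ q'))) := by rw [← hAq, ← hAq]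
    _ ≤ L * (‖(Ae.symm : E3 →L[ℝ] E3)‖₊ * edist (A (φ q)) (A (φ q'))) := by
        gcongr
        exact (Ae.symm : E3 →L[ℝ] E3).lipschitz.edist_le_mul _ _
    _ ≤ L * (‖(Ae.symm : E3 →L[ℝ] E3)‖₊ * ((2 : ℝ≥0) * riemannianEDist (𝓡 3) q q')) := by
        gcongr
        exact hge q hq.1 q' hq'.1
    _ = (L * (‖(Ae.symm : E3 →L[ℝ] E3)‖₊ * 2) : ℝ≥0) * edist q q' := by
        rw [show edist q q' = riemannianEDist (𝓡 3) q q' from rfl]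
        push_cast
        ring

/-- **Reciprocals of locally Lipschitz functions bounded away from zero are locally Lipschitz**:
`|ψ(y)⁻¹ − ψ(z)⁻¹| = |ψ(y) − ψ(z)| / (ψ(y) ψ(z)) ≤ ε⁻² |ψ(y) − ψ(z)|`. [folklore] -/
theorem IsLocLipschitzOn.inv_of_le {ψ : X → ℝ} {W : Set X} {ε : ℝ} (hε : 0 < ε)
    (hψ : IsLocLipschitzOn h ψ W) (hψε : ∀ x, ε ≤ ψ x) :
    IsLocLipschitzOn h (fun x ↦ (ψ x)⁻¹) W := by
  letI : RiemannianBundle (fun x : X ↦ TangentSpace (𝓡 3) x) :=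
    ⟨h.toContinuousRiemannianMetric.toRiemannianMetric⟩
  letI : PseudoEMetricSpace X := .ofRiemannianMetric (𝓡 3) X
  intro x hx
  obtain ⟨K, t, ht, hK⟩ := (show LocallyLipschitzOn W ψ from hψ) hx
  refine ⟨⟨ε⁻¹ * ε⁻¹, by positivity⟩ * K, t, ht, ?_⟩
  intro y hy z hz
  have hψy : 0 < ψ y := hε.trans_le (hψε y)
  have hψz : 0 < ψ z := hε.trans_le (hψε z)
  have hKyz := hK hy hz
  rw [edist_dist, Real.dist_eq] at hKyz
  show edist ((ψ y)⁻¹) ((ψ z)⁻¹) ≤ _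
  rw [edist_dist, Real.dist_eq]
  have hdiff : |(ψ y)⁻¹ - (ψ z)⁻¹| = |ψ y - ψ z| / (ψ y * ψ z) := by
    rw [inv_sub_inv hψy.ne' hψz.ne', abs_div, abs_of_pos (mul_pos hψy hψz), abs_sub_comm]
  have hle : |(ψ y)⁻¹ - (ψ z)⁻¹| ≤ (ε⁻¹ * ε⁻¹) * |ψ y - ψ z| := by
    rw [hdiff, div_eq_mul_inv, mul_comm]
    refine mul_le_mul_of_nonneg_right ?_ (abs_nonneg _)
    rw [mul_inv]
    exact mul_le_mul (inv_anti₀ hε (hψε y)) (inv_anti₀ hε (hψε z)) (by positivity) (by positivity)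
  calc ENNReal.ofReal |(ψ y)⁻¹ - (ψ z)⁻¹| ≤ ENNReal.ofReal ((ε⁻¹ * ε⁻¹) * |ψ y - ψ z|) :=
        ENNReal.ofReal_le_ofReal hle
    _ = ENNReal.ofReal (ε⁻¹ * ε⁻¹) * ENNReal.ofReal |ψ y - ψ z| :=
        ENNReal.ofReal_mul (by positivity)
    _ ≤ ENNReal.ofReal (ε⁻¹ * ε⁻¹) * (K * edist y z) := by gcongr
    _ = ((⟨ε⁻¹ * ε⁻¹, by positivity⟩ * K : ℝ≥0) : ℝ≥0∞) * edist y z := by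
        rw [ENNReal.coe_mul, mul_assoc]
        congr 1
        rw [ENNReal.ofReal_eq_coe_nnreal (by positivity)]
        rfl

end LocLipschitz

/-! ### Integrability of `h⁻¹(dw, du)` for Lipschitz `w` with compact support -/

section Integrable

variable [T2Space X] [LocallyCompactSpace X] [MeasurableSpace X] [BorelSpace X]
  [SecondCountableTopology X]

omit [IsManifold (𝓡 3) ∞ X] [T2Space X] [LocallyCompactSpace X] [MeasurableSpace X] [BorelSpace X]
  [SecondCountableTopology X] in
set_option backward.isDefEq.respectTransparency false in
/-- **Difference rule, applied form**: `d(v − u)_x(ξ) = dv_x(ξ) − du_x(ξ)`. [folklore] -/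
theorem mvfderiv_sub_apply {v u : X → ℝ} {x : X} (hv : MDifferentiableAt (𝓡 3) 𝓘(ℝ, ℝ) v x)
    (hu : MDifferentiableAt (𝓡 3) 𝓘(ℝ, ℝ) u x) (ξ : TangentSpace (𝓡 3) x) :
    mvfderiv (𝓡 3) (fun y ↦ v y - u y) x ξ = mvfderiv (𝓡 3) v x ξ - mvfderiv (𝓡 3) u x ξ := by
  have hsub := hv.hasMFDerivAt.sub hu.hasMFDerivAt
  have hfun : (fun y ↦ v y - u y) = v - u := rfl
  rw [show mvfderiv (𝓡 3) (fun y ↦ v y - u y) x ξ =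
    ((by exact mfderiv (𝓡 3) 𝓘(ℝ, ℝ) (fun y ↦ v y - u y) x : TangentSpace (𝓡 3) x →L[ℝ] ℝ)) ξ
    from rfl, hfun, hsub.mfderiv]
  rfl

/-- **Integrability of `h⁻¹(dw, df)`** for `w` locally Lipschitz (Riemannian distance) with compact
support and `f ∈ C¹`: a smooth partition of unity on `tsupport w` subordinate to chart domains
reduces to `integrable_innerDual_of_isLocLipschitzOn` (the differential of `w = ∑ ρᵢ w` is
`∑ d(ρᵢ w)` at differentiability points). [folklore] -/
theorem integrable_innerDual_of_hasCompactSupport {w f : X → ℝ} (hw : IsLocLipschitzOn h w univ)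
    (hwc : HasCompactSupport w) (hf : ContMDiff (𝓡 3) 𝓘(ℝ, ℝ) 1 f) :
    Integrable (fun p ↦ (ofRiemannian h).innerDual p (mvfderiv (𝓡 3) w p).toLinearMap
      (mvfderiv (𝓡 3) f p).toLinearMap) (riemannianMeasure h) := by
  classical
  have hwcont : Continuous w := hw.continuous h
  obtain ⟨ρ, hρ⟩ := SmoothPartitionOfUnity.exists_isSubordinate (𝓡 3) (isClosed_tsupport w)
    (fun x : X ↦ (chartAt E3 x).source) (fun x ↦ (chartAt E3 x).open_source)
    (fun y _ ↦ mem_iUnion.2 ⟨y, mem_chart_source E3 y⟩)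
  have hfin : {i | (support (ρ i) ∩ tsupport w).Nonempty}.Finite :=
    ρ.locallyFinite.finite_nonempty_inter_compact hwc
  set I₀ := hfin.toFinset with hI₀
  clear_value I₀
  have hsumρ : ∀ p ∈ tsupport w, ∑ i ∈ I₀, ρ i p = 1 := by
    intro p hp
    have h1 : ∑ᶠ i, ρ i p = 1 := ρ.sum_eq_one hp
    have h2 : ∑ᶠ i, ρ i p = ∑ i ∈ I₀, ρ i p := by
      refine finsum_eq_sum_of_support_subset _ fun i hi ↦ ?_
      rw [Finset.mem_coe, hI₀, Set.Finite.mem_toFinset]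
      exact ⟨p, hi, hp⟩
    rw [← h2, h1]
  have hρ1 : ∀ i, ContMDiff (𝓡 3) 𝓘(ℝ, ℝ) 1 (ρ i) := fun i ↦
    (ρ i).contMDiff.of_le (by exact_mod_cast le_top)
  have hwp_lip : ∀ i, IsLocLipschitzOn h (fun p ↦ ρ i p * w p) univ := fun i ↦
    (isLocLipschitzOn_of_contMDiff h (hρ1 i)).mul h hw
  have hwp_c : ∀ i, HasCompactSupport (fun p ↦ ρ i p * w p) := fun i ↦ hwc.mul_left
  have hwp_supp : ∀ i, tsupport (fun p ↦ ρ i p * w p) ⊆ (extChartAt (𝓡 3) i).source := fun i ↦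
    ((tsupport_mul_subset_left (f := (ρ i : X → ℝ)) (g := w)).trans (hρ i)).trans
      (extChartAt_source (𝓡 3) i).symm.subset
  have hIR : ∀ i, Integrable (fun p ↦ (ofRiemannian h).innerDual p
      (mvfderiv (𝓡 3) (fun p ↦ ρ i p * w p) p).toLinearMap (mvfderiv (𝓡 3) f p).toLinearMap)
      (riemannianMeasure h) := fun i ↦
    integrable_innerDual_of_isLocLipschitzOn h i (hwp_lip i) (hwp_c i) (hwp_supp i) hf
  refine (integrable_finsetSum I₀ fun i _ ↦ hIR i).congr ?_
  filter_upwards [hw.ae_mdifferentiableAt h isOpen_univ] with p hp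
  have hwd := hp (mem_univ p)
  simp only [PseudoRiemannianMetric.innerDual]
  set v := (ofRiemannian h).sharp p (mvfderiv (𝓡 3) f p).toLinearMap with hv
  change ∑ i ∈ I₀, mvfderiv (𝓡 3) (fun q ↦ ρ i q * w q) p v = mvfderiv (𝓡 3) w p v
  have hprod : ∀ i, mvfderiv (𝓡 3) (fun q ↦ ρ i q * w q) p v =
      ρ i p * mvfderiv (𝓡 3) w p v + w p * mvfderiv (𝓡 3) (ρ i) p v := fun i ↦
    mvfderiv_mul_apply ((hρ1 i).mdifferentiableAt one_ne_zero) hwd v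
  simp only [hprod, Finset.sum_add_distrib, ← Finset.sum_mul, ← Finset.mul_sum]
  by_cases hpw : p ∈ tsupport w
  · rw [hsumρ p hpw, one_mul]
    by_cases hw0 : w p = 0
    · rw [hw0, zero_mul, add_zero]
    · have hopen : support w ∈ 𝓝 p :=
        (isOpen_compl_singleton.preimage hwcont).mem_nhds hw0
      have hev : (fun _ ↦ (1 : ℝ)) =ᶠ[𝓝 p] fun q ↦ ∑ i ∈ I₀, ρ i q := by
        filter_upwards [hopen] with q hq
        exact (hsumρ q (subset_tsupport _ hq)).symm
      have hS := (mvfderiv_finset_sum (I := 𝓡 3) I₀ (F := fun i q ↦ ρ i q) (p := p)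
        fun i _ ↦ (hρ1 i).mdifferentiableAt one_ne_zero).2
      have hd0 : mvfderiv (𝓡 3) (fun q ↦ ∑ i ∈ I₀, ρ i q) p = 0 := by
        have h0 : HasMFDerivAt (𝓡 3) 𝓘(ℝ, ℝ) (fun q ↦ ∑ i ∈ I₀, ρ i q) p
            (0 : TangentSpace (𝓡 3) p →L[ℝ] ℝ) :=
          (hasMFDerivAt_const (1 : ℝ) p).congr_of_eventuallyEq hev.symm
        exact h0.mfderiv
      have hsum0 : ∑ i ∈ I₀, mvfderiv (𝓡 3) (ρ i) p v = 0 := by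
        have h1 : (∑ i ∈ I₀, mvfderiv (𝓡 3) (fun q ↦ ρ i q) p) v = 0 := by
          rw [← hS, hd0, zero_apply]
        rw [FunLike.coe_sum, Finset.sum_apply] at h1
        exact h1
      rw [hsum0, mul_zero, add_zero]
  · have hw0 : w p = 0 := image_eq_zero_of_notMem_tsupport hpw
    have hdw : mvfderiv (𝓡 3) w p = 0 := mvfderiv_eq_zero_of_notMem_tsupport hpw
    simp only [hw0, hdw, zero_mul, add_zero, zero_apply, mul_zero]

end Integrable

/-! ### The `ε`-approximate minimising property of classical solutions of (⋆)_ε -/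

section Calibration

variable [T2Space X] [LocallyCompactSpace X] [MeasurableSpace X] [BorelSpace X]
  [SecondCountableTopology X] [(ofRiemannian h).HasLeviCivita]

set_option backward.isDefEq.respectTransparency false in
/-- **Classical solutions of the elliptic regularisation are `ε`-approximate weak solutions.**
Let `W ⊆ X` be open, `u ∈ C²(X)`, `ε > 0`, `ψ = √(|∇u|² + ε²)` (pointwise), `ψ ∈ C¹(W)`, and
suppose `u` solves Huisken–Ilmanen's regularised equation (⋆)_ε,
`div(∇u/ψ) = ψ`, on `W`, in the expanded classical form `ψ Δ_h u − h⁻¹(dψ, du) = ψ³`. Then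
for every `v` locally Lipschitz on `W` and every compact `K ⊆ W` containing `{v ≠ u} ∩ W`,

  `J_u^K(u) ≤ J_u^K(v) + ε (μ_h(K) + ∫_K |v − u| dμ_h)`.

Proof (the calibration of Huisken–Ilmanen's Lemma 2.3 with `ν = ∇u/ψ`, `|ν| < 1`): a.e. on `K`,
`|∇v| ≥ h⁻¹(dv, du)/ψ = |∇u|²/ψ + h⁻¹(d(v−u), du)/ψ ≥ |∇u| − ε + h⁻¹(d(v−u), du)/ψ`
(Cauchy–Schwarz, `0 ≤ ψ − |∇u| ≤ ε`); Green's identity against the Lipschitz test function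
`(v − u)/ψ` (`integral_mul_dalembertian_eq_neg_integral_innerDual_of_isLocLipschitzOn`) and the
equation give `∫ h⁻¹(d(v − u), du)/ψ = −∫ (v − u) ψ ≥ −∫ (v − u)|∇u| − ε ∫ |v − u|`.
Huisken–Ilmanen use (⋆)_ε through the translating graphs `u − εz` in `M × ℝ` (Lemma 2.3 + Thm. 2.1,
p. 26–27); this estimate is the same calibration carried out on `M`.
[cite: HuiskenIlmanenIMCF2001, §3 (⋆)_ε and §2 proof of Lemma 2.3] -/
theorem imcfEnergy_le_add_of_regularised {W : Set X} (hW : IsOpen W) {u : X → ℝ}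
    (hu : ContMDiff (𝓡 3) 𝓘(ℝ, ℝ) 2 u) {ε : ℝ} (hε : 0 < ε) {ψ : X → ℝ}
    (hψ : ∀ x, ψ x = Real.sqrt (gradNorm h u x ^ 2 + ε ^ 2))
    (hψ1 : ContMDiffOn (𝓡 3) 𝓘(ℝ, ℝ) 1 ψ W)
    (hpde : ∀ x ∈ W, ψ x * (ofRiemannian h).dalembertian u x -
      (ofRiemannian h).innerDual x (mvfderiv (𝓡 3) ψ x).toLinearMap
        (mvfderiv (𝓡 3) u x).toLinearMap = ψ x ^ 3)
    {v : X → ℝ} (hv : IsLocLipschitzOn h v W) {K : Set X} (hK : IsCompact K) (hKW : K ⊆ W)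
    (hvK : {x | x ∈ W ∧ v x ≠ u x} ⊆ K) :
    imcfEnergy h u K u ≤ imcfEnergy h u K v +
      ε * ((riemannianMeasure h).real K + ∫ x in K, |v x - u x| ∂riemannianMeasure h) := by
  classical
  haveI : IsFiniteMeasureOnCompacts (riemannianMeasure h) :=
    ⟨fun K hK ↦ riemannianVolume_lt_top_of_isCompact_holds h le_rfl hK⟩
  set μ := riemannianMeasure h with hμ
  have hu1 : ContMDiff (𝓡 3) 𝓘(ℝ, ℝ) 1 u := hu.of_le (by norm_num)
  have huW : IsLocLipschitzOn h u W := isLocLipschitzOn_of_contMDiff' h hu1 W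
  -- (0) `ε ≤ ψ`, `|∇u| ≤ ψ ≤ |∇u| + ε`, `ψ` continuous
  have hg0 : ∀ x, 0 ≤ gradNorm h u x := fun x ↦ gradNorm_nonneg h u x
  have hψε : ∀ x, ε ≤ ψ x := fun x ↦ by
    rw [hψ x]
    calc ε = Real.sqrt (ε ^ 2) := (Real.sqrt_sq hε.le).symm
      _ ≤ Real.sqrt (gradNorm h u x ^ 2 + ε ^ 2) := Real.sqrt_le_sqrt (by nlinarith [hg0 x])
  have hψpos : ∀ x, 0 < ψ x := fun x ↦ hε.trans_le (hψε x)
  have hψne : ∀ x, ψ x ≠ 0 := fun x ↦ (hψpos x).ne'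
  have hgψ : ∀ x, gradNorm h u x ≤ ψ x := fun x ↦ by
    rw [hψ x]
    calc gradNorm h u x = Real.sqrt (gradNorm h u x ^ 2) := (Real.sqrt_sq (hg0 x)).symm
      _ ≤ Real.sqrt (gradNorm h u x ^ 2 + ε ^ 2) := Real.sqrt_le_sqrt (by nlinarith [hε.le])
  have hψg : ∀ x, ψ x ≤ gradNorm h u x + ε := fun x ↦ by
    rw [hψ x, ← Real.sqrt_sq (by linarith [hg0 x, hε.le] : 0 ≤ gradNorm h u x + ε)]
    exact Real.sqrt_le_sqrt (by nlinarith [hg0 x, hε.le])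
  have hψfun : ψ = fun x ↦ Real.sqrt (gradNorm h u x ^ 2 + ε ^ 2) := funext hψ
  have hgc : Continuous (gradNorm h u) := by
    have h1 := continuous_innerDual_mvfderiv (ofRiemannian h) hu1 hu1
    have h2 : gradNorm h u = fun x ↦ Real.sqrt ((ofRiemannian h).innerDual x
        (mvfderiv (𝓡 3) u x).toLinearMap (mvfderiv (𝓡 3) u x).toLinearMap) := rfl
    rw [h2]
    exact Real.continuous_sqrt.comp h1
  have hψc : Continuous ψ := by
    rw [hψfun]; exact Real.continuous_sqrt.comp ((hgc.pow 2).add continuous_const)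
  have hψinvc : Continuous fun x ↦ (ψ x)⁻¹ := hψc.inv₀ hψne
  -- (1) the Lipschitz functions `f = 1_W (v - u)` and `w = f / ψ`
  set f : X → ℝ := W.indicator fun x ↦ v x - u x with hf
  have hfW : ∀ x ∈ W, f x = v x - u x := fun x hx ↦ by rw [hf, indicator_of_mem hx]
  have hfK0 : ∀ x ∉ K, f x = 0 := by
    intro x hx
    by_cases hxW : x ∈ W
    · rw [hfW x hxW]
      have : v x = u x := by by_contra hne; exact hx (hvK ⟨hxW, hne⟩)
      rw [this, sub_self]
    · rw [hf, indicator_of_notMem hxW]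
  have hftsupp : tsupport f ⊆ K :=
    closure_minimal (fun x hx ↦ by_contra fun hxK ↦ hx (hfK0 x hxK)) hK.isClosed
  have hfc : HasCompactSupport f :=
    HasCompactSupport.of_support_subset_isCompact hK ((subset_tsupport f).trans hftsupp)
  have hflipW : IsLocLipschitzOn h f W := by
    have := (hv.sub h huW)
    refine isLocLipschitzOn_of_eqOn_of_eqOn h hW hK.isClosed hKW (isLocLipschitzOn_const h 0 W)
      this (fun x hx ↦ hfW x hx) (fun x hx ↦ hfK0 x hx.2)
  have hflip : IsLocLipschitzOn h f univ :=
    isLocLipschitzOn_of_eqOn_of_eqOn h hW hK.isClosed hKW (isLocLipschitzOn_const h 0 univ)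
      (hv.sub h huW) (fun x hx ↦ hfW x hx) (fun x hx ↦ hfK0 x hx.2)
  have hfcont : Continuous f := hflip.continuous h
  have hψW : IsLocLipschitzOn h ψ W := isLocLipschitzOn_of_contMDiffOn h hW hψ1
  have hinvW : IsLocLipschitzOn h (fun x ↦ (ψ x)⁻¹) W := hψW.inv_of_le h hε hψε
  set w : X → ℝ := fun x ↦ f x * (ψ x)⁻¹ with hw
  have hwlip : IsLocLipschitzOn h w univ :=
    isLocLipschitzOn_of_eqOn_of_eqOn h hW hK.isClosed hKW (isLocLipschitzOn_const h 0 univ)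
      (hflipW.mul h hinvW) (fun x _ ↦ rfl) (fun x hx ↦ by simp [hw, hfK0 x hx.2])
  have hwc : HasCompactSupport w := hfc.mul_right
  have hwtsupp : tsupport w ⊆ K :=
    (tsupport_mul_subset_left (f := f) (g := fun x ↦ (ψ x)⁻¹)).trans hftsupp
  -- (2) Green's identity against `w`
  have hG := integral_mul_dalembertian_eq_neg_integral_innerDual_of_isLocLipschitzOn h hwlip hwc hu
  -- (3) `h⁻¹(dw, du) = h⁻¹(df, du)/ψ − f Δu/ψ + f ψ` a.e. (quotient rule and the equation)
  have hΔc : Continuous ((ofRiemannian h).dalembertian u) := continuous_dalembertian _ hu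
  have hE1 : ∀ᵐ x ∂μ, (ofRiemannian h).innerDual x (mvfderiv (𝓡 3) w x).toLinearMap
      (mvfderiv (𝓡 3) u x).toLinearMap =
      (ofRiemannian h).innerDual x (mvfderiv (𝓡 3) f x).toLinearMap
        (mvfderiv (𝓡 3) u x).toLinearMap * (ψ x)⁻¹ -
      f x * (ofRiemannian h).dalembertian u x * (ψ x)⁻¹ + f x * ψ x := by
    filter_upwards [hflip.ae_mdifferentiableAt h isOpen_univ] with x hx
    have hfx := hx (mem_univ x)
    by_cases hxW : x ∈ W
    · have hψx : MDifferentiableAt (𝓡 3) 𝓘(ℝ, ℝ) ψ x :=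
        (hψ1.contMDiffAt (hW.mem_nhds hxW)).mdifferentiableAt one_ne_zero
      have hlin : (mvfderiv (𝓡 3) w x).toLinearMap =
          (ψ x)⁻¹ • (mvfderiv (𝓡 3) f x).toLinearMap +
          (-(f x * ((ψ x)⁻¹ * (ψ x)⁻¹))) • (mvfderiv (𝓡 3) ψ x).toLinearMap := by
        apply LinearMap.ext
        intro ξ
        simp only [LinearMap.add_apply, LinearMap.smul_apply, smul_eq_mul,
          ContinuousLinearMap.coe_coe]
        have hq := mvfderiv_div_apply hfx hψx hψne ξ
        rw [show (mvfderiv (𝓡 3) w x) ξ = mvfderiv (𝓡 3) (fun y ↦ f y * (ψ y)⁻¹) x ξ from rfl, hq]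
        have := hψne x
        field_simp
        ring
      have hpde' : (ofRiemannian h).innerDual x (mvfderiv (𝓡 3) ψ x).toLinearMap
          (mvfderiv (𝓡 3) u x).toLinearMap = ψ x * (ofRiemannian h).dalembertian u x - ψ x ^ 3 := by
        have := hpde x hxW; linarith
      rw [hlin, innerDual_add_left, innerDual_smul_left', innerDual_smul_left', hpde']
      have := hψne x
      field_simp
      ring
    · have hxK : x ∉ K := fun h' ↦ hxW (hKW h')
      have hdw : mvfderiv (𝓡 3) w x = 0 :=
        mvfderiv_eq_zero_of_notMem_tsupport fun h' ↦ hxK (hwtsupp h')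
      have hdf : mvfderiv (𝓡 3) f x = 0 :=
        mvfderiv_eq_zero_of_notMem_tsupport fun h' ↦ hxK (hftsupp h')
      simp only [hdw, hdf, hfK0 x hxK, zero_mul, sub_zero, add_zero]
      simp [PseudoRiemannianMetric.innerDual]
  -- (4) integrability
  have hI_dw := integrable_innerDual_of_hasCompactSupport h hwlip hwc hu1
  have hI_df := integrable_innerDual_of_hasCompactSupport h hflip hfc hu1
  have hI_A : Integrable (fun x ↦ (ofRiemannian h).innerDual x (mvfderiv (𝓡 3) f x).toLinearMap
      (mvfderiv (𝓡 3) u x).toLinearMap * (ψ x)⁻¹) μ := by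
    refine hI_df.mul_bdd hψinvc.aestronglyMeasurable (c := ε⁻¹) (Eventually.of_forall fun x ↦ ?_)
    rw [Real.norm_eq_abs, abs_of_pos (inv_pos.2 (hψpos x))]
    exact inv_anti₀ hε (hψε x)
  have hI_fΔ : Integrable (fun x ↦ f x * (ofRiemannian h).dalembertian u x * (ψ x)⁻¹) μ :=
    ((hfcont.mul hΔc).mul hψinvc).integrable_of_hasCompactSupport (hfc.mul_right.mul_right)
  have hI_fψ : Integrable (fun x ↦ f x * ψ x) μ :=
    (hfcont.mul hψc).integrable_of_hasCompactSupport hfc.mul_right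
  -- (5) `A := ∫ h⁻¹(df, du)/ψ = −∫ f ψ =: −B`
  have hLHS : ∫ x, w x * (ofRiemannian h).dalembertian u x ∂μ =
      ∫ x, f x * (ofRiemannian h).dalembertian u x * (ψ x)⁻¹ ∂μ := by
    refine integral_congr_ae (Eventually.of_forall fun x ↦ ?_)
    simp only [hw]; ring
  have hRHS : ∫ x, (ofRiemannian h).innerDual x (mvfderiv (𝓡 3) w x).toLinearMap
      (mvfderiv (𝓡 3) u x).toLinearMap ∂μ =
      (∫ x, (ofRiemannian h).innerDual x (mvfderiv (𝓡 3) f x).toLinearMap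
        (mvfderiv (𝓡 3) u x).toLinearMap * (ψ x)⁻¹ ∂μ) -
      (∫ x, f x * (ofRiemannian h).dalembertian u x * (ψ x)⁻¹ ∂μ) + ∫ x, f x * ψ x ∂μ := by
    have hIAB : Integrable (fun x ↦ (ofRiemannian h).innerDual x (mvfderiv (𝓡 3) f x).toLinearMap
        (mvfderiv (𝓡 3) u x).toLinearMap * (ψ x)⁻¹ -
        f x * (ofRiemannian h).dalembertian u x * (ψ x)⁻¹) μ := hI_A.sub hI_fΔ
    rw [integral_congr_ae hE1, integral_add hIAB hI_fψ, integral_sub hI_A hI_fΔ]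
  have hE2 : (∫ x, (ofRiemannian h).innerDual x (mvfderiv (𝓡 3) f x).toLinearMap
      (mvfderiv (𝓡 3) u x).toLinearMap * (ψ x)⁻¹ ∂μ) = -∫ x, f x * ψ x ∂μ := by
    rw [hLHS, hRHS] at hG
    linarith
  -- (6) the pointwise calibration inequality, a.e. on `K`
  have hE3 : ∀ᵐ x ∂μ, x ∈ K → gradNorm h u x - ε +
      (ofRiemannian h).innerDual x (mvfderiv (𝓡 3) f x).toLinearMap
        (mvfderiv (𝓡 3) u x).toLinearMap * (ψ x)⁻¹ ≤ gradNorm h v x := by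
    filter_upwards [hv.ae_mdifferentiableAt h hW] with x hvx hxK
    have hxW := hKW hxK
    have hvd := hvx hxW
    have hud : MDifferentiableAt (𝓡 3) 𝓘(ℝ, ℝ) u x := hu1.mdifferentiableAt one_ne_zero
    -- `df = dv - du` at `x`
    have hfev : f =ᶠ[𝓝 x] fun y ↦ v y - u y := by
      filter_upwards [hW.mem_nhds hxW] with y hy using hfW y hy
    have hsplit : (ofRiemannian h).innerDual x (mvfderiv (𝓡 3) f x).toLinearMap
        (mvfderiv (𝓡 3) u x).toLinearMap =
        (ofRiemannian h).innerDual x (mvfderiv (𝓡 3) v x).toLinearMap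
          (mvfderiv (𝓡 3) u x).toLinearMap -
        (ofRiemannian h).innerDual x (mvfderiv (𝓡 3) u x).toLinearMap
          (mvfderiv (𝓡 3) u x).toLinearMap := by
      simp only [PseudoRiemannianMetric.innerDual]
      set s := (ofRiemannian h).sharp x (mvfderiv (𝓡 3) u x).toLinearMap
      change mvfderiv (𝓡 3) f x s = mvfderiv (𝓡 3) v x s - mvfderiv (𝓡 3) u x s
      rw [mvfderiv_congr_of_eventuallyEq hfev, mvfderiv_sub_apply hvd hud]
    have hCS := innerDual_le_gradNorm_mul_gradNorm h v u x
    have hself := innerDual_self_eq_gradNorm_sq h u x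
    have hψx := hψpos x
    have hgv := gradNorm_nonneg h v x
    have hgu := hg0 x
    -- `h⁻¹(dv,du)/ψ ≤ |∇v|` and `|∇u|²/ψ ≥ |∇u| − ε`
    have h1 : (ofRiemannian h).innerDual x (mvfderiv (𝓡 3) v x).toLinearMap
        (mvfderiv (𝓡 3) u x).toLinearMap * (ψ x)⁻¹ ≤ gradNorm h v x := by
      rw [← div_eq_mul_inv, div_le_iff₀ hψx]
      exact hCS.trans (mul_le_mul_of_nonneg_left (hgψ x) hgv)
    have h2 : gradNorm h u x - ε ≤ gradNorm h u x ^ 2 * (ψ x)⁻¹ := by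
      rw [← div_eq_mul_inv, le_div_iff₀ hψx]
      rcases le_or_gt ε (gradNorm h u x) with hge | hlt
      · calc (gradNorm h u x - ε) * ψ x ≤ (gradNorm h u x - ε) * (gradNorm h u x + ε) :=
            mul_le_mul_of_nonneg_left (hψg x) (by linarith)
          _ = gradNorm h u x ^ 2 - ε ^ 2 := by ring
          _ ≤ gradNorm h u x ^ 2 := by nlinarith
      · have hneg : gradNorm h u x - ε < 0 := by linarith
        nlinarith [mul_neg_of_neg_of_pos hneg hψx, sq_nonneg (gradNorm h u x)]
    rw [hsplit, sub_mul, hself]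
    linarith
  -- (7) `f ψ ≤ f |∇u| + ε |f|` pointwise
  have hE4 : ∀ x, f x * ψ x ≤ f x * gradNorm h u x + ε * |f x| := by
    intro x
    have h1 : f x * (ψ x - gradNorm h u x) ≤ |f x| * ε := by
      calc f x * (ψ x - gradNorm h u x) ≤ |f x * (ψ x - gradNorm h u x)| := le_abs_self _
        _ = |f x| * (ψ x - gradNorm h u x) := by
            rw [abs_mul, abs_of_nonneg (sub_nonneg.2 (hgψ x))]
        _ ≤ |f x| * ε := mul_le_mul_of_nonneg_left (by linarith [hψg x]) (abs_nonneg _)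
    nlinarith [h1]
  -- (8) integrate over `K`
  have hIv : IntegrableOn (gradNorm h v) K μ := hv.integrableOn_gradNorm h hW hK hKW
  have hIu : IntegrableOn (gradNorm h u) K μ := huW.integrableOn_gradNorm h hW hK hKW
  have hIAK : IntegrableOn (fun x ↦ (ofRiemannian h).innerDual x (mvfderiv (𝓡 3) f x).toLinearMap
      (mvfderiv (𝓡 3) u x).toLinearMap * (ψ x)⁻¹) K μ := hI_A.integrableOn
  have hKfin : μ K ≠ ⊤ := (hK.measure_lt_top (μ := μ)).ne
  have hIc : IntegrableOn (fun _ : X ↦ ε) K μ := integrableOn_const hKfin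
  have hI1 : IntegrableOn (fun x ↦ gradNorm h u x - ε) K μ := hIu.sub hIc
  have hI12 : IntegrableOn (fun x ↦ gradNorm h u x - ε +
      (ofRiemannian h).innerDual x (mvfderiv (𝓡 3) f x).toLinearMap
        (mvfderiv (𝓡 3) u x).toLinearMap * (ψ x)⁻¹) K μ := hI1.add hIAK
  have hstep1 : (∫ x in K, gradNorm h u x ∂μ) - ε * μ.real K +
      (∫ x in K, (ofRiemannian h).innerDual x (mvfderiv (𝓡 3) f x).toLinearMap
        (mvfderiv (𝓡 3) u x).toLinearMap * (ψ x)⁻¹ ∂μ) ≤ ∫ x in K, gradNorm h v x ∂μ := by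
    have hmono := integral_mono_ae hI12 hIv
      ((ae_restrict_iff' hK.measurableSet).2 (hE3.mono fun x hx hxK ↦ hx hxK))
    rw [integral_add hI1 hIAK, integral_sub hIu hIc, setIntegral_const, smul_eq_mul,
      mul_comm] at hmono
    exact hmono
  -- the `A`-integral lives on `K`
  have hAK : (∫ x in K, (ofRiemannian h).innerDual x (mvfderiv (𝓡 3) f x).toLinearMap
      (mvfderiv (𝓡 3) u x).toLinearMap * (ψ x)⁻¹ ∂μ) =
      ∫ x, (ofRiemannian h).innerDual x (mvfderiv (𝓡 3) f x).toLinearMap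
        (mvfderiv (𝓡 3) u x).toLinearMap * (ψ x)⁻¹ ∂μ := by
    refine setIntegral_eq_integral_of_forall_compl_eq_zero fun x hx ↦ ?_
    rw [mvfderiv_eq_zero_of_notMem_tsupport fun h' ↦ hx (hftsupp h')]
    simp [PseudoRiemannianMetric.innerDual]
  have hBK : ∫ x, f x * ψ x ∂μ = ∫ x in K, f x * ψ x ∂μ :=
    (setIntegral_eq_integral_of_forall_compl_eq_zero fun x hx ↦ by rw [hfK0 x hx, zero_mul]).symm
  -- `∫_K f ψ ≤ ∫_K (v - u)|∇u| + ε ∫_K |v - u|`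
  have hcvu : ContinuousOn (fun x ↦ v x - u x) K :=
    ((hv.continuousOn h).sub (huW.continuousOn h)).mono hKW
  have hIfg : IntegrableOn (fun x ↦ (v x - u x) * gradNorm h u x) K μ :=
    huW.integrableOn_mul_gradNorm h hW hK hKW hcvu
  have hIabs : IntegrableOn (fun x ↦ |v x - u x|) K μ := hcvu.abs.integrableOn_compact hK
  have hIfψ : IntegrableOn (fun x ↦ f x * ψ x) K μ := hI_fψ.integrableOn
  have hstep2 : ∫ x in K, f x * ψ x ∂μ ≤
      (∫ x in K, (v x - u x) * gradNorm h u x ∂μ) + ε * ∫ x in K, |v x - u x| ∂μ := by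
    have hmono : ∫ x in K, f x * ψ x ∂μ ≤
        ∫ x in K, ((v x - u x) * gradNorm h u x + ε * |v x - u x|) ∂μ := by
      refine setIntegral_mono_on hIfψ (hIfg.add (hIabs.const_mul ε)) hK.measurableSet
        fun x hx ↦ ?_
      have := hE4 x
      rw [hfW x (hKW hx)] at this ⊢
      exact this
    rw [integral_add hIfg (hIabs.const_mul ε), integral_const_mul] at hmono
    exact hmono
  -- (9) assemble
  have hJu : imcfEnergy h u K u = (∫ x in K, gradNorm h u x ∂μ) +
      ∫ x in K, u x * gradNorm h u x ∂μ := imcfEnergy_eq_integral_add h huW huW hW hK hKW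
  have hJv : imcfEnergy h u K v = (∫ x in K, gradNorm h v x ∂μ) +
      ∫ x in K, v x * gradNorm h u x ∂μ := imcfEnergy_eq_integral_add h huW hv hW hK hKW
  have hIug : IntegrableOn (fun x ↦ u x * gradNorm h u x) K μ :=
    huW.integrableOn_mul_gradNorm h hW hK hKW ((huW.continuousOn h).mono hKW)
  have hIvg : IntegrableOn (fun x ↦ v x * gradNorm h u x) K μ :=
    huW.integrableOn_mul_gradNorm h hW hK hKW ((hv.continuousOn h).mono hKW)
  have hsplitvu : ∫ x in K, (v x - u x) * gradNorm h u x ∂μ =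
      (∫ x in K, v x * gradNorm h u x ∂μ) - ∫ x in K, u x * gradNorm h u x ∂μ := by
    rw [← integral_sub hIvg hIug]
    refine integral_congr_ae (Eventually.of_forall fun x ↦ ?_)
    simp only; ring
  rw [hJu, hJv]
  rw [hAK, hE2, hBK] at hstep1
  rw [hsplitvu] at hstep2
  nlinarith [hstep1, hstep2, hε]

end Calibration


end Literature.Geometry.Lorentzian

end
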